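import Literature.NumberTheory.Sieve.PrimeDivisorsOfPolynomials
import Literature.NumberTheory.Sieve.ParityWave0
import HarnessLib

/-!
# Barrier catalogue `Parity`: Murty's impossibility theorem — "Euclidean" proofs of
# Dirichlet's theorem exist for the progression `a mod m` only if `a² ≡ 1 (mod m)`
# (Schur 1912 ⟸; Murty 1988 ⟹; Pollack 2010: the same under Hypothesis H for the wider
# class of `E′`-polynomials)

Catalogue entry (D-0021) for the summit `Parity`, sub-problem `BatemanHorn`
(`Literature.NumberTheory.Sieve.BatemanHornConjecture`; tree siblings `Literature.NumberTheory.Sieve.BunyakovskyConjecture`,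
`Literature.NumberTheory.Sieve.SchinzelHypothesisH`, `Literature.NumberTheory.Sieve.DicksonConjecture`). The degree-one, one-polynomial
case `f = mT + a` of Bunyakovsky / Bateman–Horn is, qualitatively, Dirichlet's theorem on primes
in the progression `a mod m` — "the Chebotarev density theorem, Bunyakovsky's conjecture, and
Hypothesis H all contain Dirichlet's theorem as a special case" (Pollack). The technique class
catalogued here is the oldest one: arguments "in the style of Euclid", which exhibit a polynomial
whose values have prime divisors confined (with finitely many exceptions) to the classes `1` and
`a mod m` and meeting the class `a` infinitely often (Murty's `E`-polynomials; Conrad's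
"Euclidean polynomials"). Schur (1912) constructed such a polynomial whenever `a² ≡ 1 (mod m)`;
Murty (1988) proved the converse — NO such polynomial exists unless `a² ≡ 1 (mod m)` — using the
Chebotarev density theorem; Pollack (2010) widened the class to `E′`-polynomials (every large
value has a prime factor `≡ a (mod m)`, and no prime `≡ a` is a fixed divisor) and proved the same
impossibility for it ASSUMING Schinzel's Hypothesis H.

* `IsPrimeDivisorOf f p` — `p` is a prime divisor of `f ∈ ℤ[T]` (`p ∣ f(n)` for some `n ∈ ℤ`;
  Schur's theorem that a non-constant `f` has infinitely many is the tree's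
  `Literature.NumberTheory.Sieve.schur_exists_prime_dvd_eval`); `primeDivisorClasses f m = S(f, m)`, the set of classes
  `mod m` containing infinitely many prime divisors of `f`;
* `IsEuclideanPolynomial f a m` — Murty's `E`-polynomial for `a mod m` (Pollack's (2) ∧ (3);
  Conrad's "Euclidean polynomial", non-constant) — THE TECHNIQUE CLASS;
  `IsEPrimePolynomial f a m` — the Pollack–Snyder `E′`-polynomial ((i) ∧ (ii));
* named facts: `PrimeDivisorClassesSubgroup` (Pollack's Theorem 2 = Conrad's Theorem 4: for
  `f` non-constant and irreducible over `ℚ`, `S(f, m)` is a subgroup of `(ℤ/mℤ)ˣ` — the image of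
  `Gal(K(ζ_m)/K) → Gal(ℚ(ζ_m)/ℚ)`, by Chebotarev; only the subgroup assertion is transcribed);
  `EuclideanProofBarrier` (Murty's impossibility theorem; docstring = BARRIER block);
  `Schur1912_euclideanPolynomial` (Schur's existence theorem); `Pollack2010_ePrime` (Theorem 1,
  "assuming Hypothesis H", stated as the implication from the tree's `Literature.NumberTheory.Sieve.SchinzelHypothesisH`);
* PROVED: `euclideanProofBarrier_of_subgroup` — Murty's theorem from the subgroup fact, exactly
  as printed ("Given an E-polynomial … it must have an irreducible factor which is also an
  E-polynomial … `{a mod m} ⊂ S(f, m) ⊂ {1 mod m, a mod m}`. This easily implies `a² ≡ 1 (mod m)`"):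
  `IsEuclideanPolynomial.exists_irreducible` (pigeonhole over the irreducible factors in the UFD
  `ℤ[X]`, constants excluded) and the group-theoretic step; and the sanity instance
  `isEuclideanPolynomial_X_neg_one_four` (`T` is an `E`-polynomial for `−1 mod 4`, Pollack's
  Table 7.1, using Mathlib's Dirichlet theorem for the infinitude clause).

## What the sources print (verified on the page)

* P. Pollack, *Hypothesis H and an impossibility theorem of Ram Murty*, Rend. Sem. Mat. Univ.
  Politec. Torino 68 (2010) 183–197 [cite: Pollack2010MurtyH, §1.1, §2.1 (2)–(3), §2.2 (Lemma 1, Theorem 1), §3 (Theorem 2, Lemma 3), §5.1–5.2, Table 7.1].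
  Abstract: "In 1912, Schur showed that one can construct an argument of this type for every
  progression `a mod m` satisfying `a² ≡ 1 (mod m)`, and in 1988 Murty showed that these are the
  only progressions for which such an argument can be given. Murty's proof uses some deep results
  from algebraic number theory (in particular the Chebotarev density theorem). … We also propose a
  widening of Murty's definition of a Euclidean proof. … assuming Schinzel's Hypothesis H, we show
  that again such a proof exists only when `a² ≡ 1 (mod m)`." §1.1: "MURTY'S IMPOSSIBILITY
  THEOREM. Unless (1) [`a² ≡ 1 (mod m)`] holds, there is no Euclidean proof of Dirichlet's
  theorem for the progression `a mod m`. For example, there is no Euclidean proof that there are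
  infinitely many primes `p ≡ 2 (mod 5)`." "(Note that every coprime residue class mod 24 has this
  property; it is not difficult to prove that 24 is the largest integer like this.)" "Bateman and
  Low [3] have given Euclidean proofs for all coprime residue classes mod 24." §2.1: "Call a prime
  `p` a prime divisor of the polynomial `f(T) ∈ ℤ[T]` if `f` has a root modulo `p`, i.e., if `p`
  divides `f(n)` for some integer `n`. … (2) infinitely many prime divisors `p` of `f` satisfy
  `p ≡ a (mod m)`. … (3) every prime divisor `p` of `f`, with at most finitely many exceptions,
  satisfies `p ≡ 1 (mod m)` or `p ≡ a (mod m)`. A polynomial which satisfies both (2) and (3) will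
  be called an `E`-polynomial for the progression `a mod m`. If an `E`-polynomial exists, Murty
  says that a Euclidean proof exists for the progression `a mod m`. … MURTY'S IMPOSSIBILITY
  THEOREM. There is no `E`-polynomial for the progression `a mod m` unless `a² ≡ 1 (mod m)`."
  Table 7.1 (E-polynomials): `−1 mod 4: T`; `1 mod 4: T² + 1`; `4 mod 5: T² − 5`; `1 mod 8: T⁴ + 1`;
  `3 mod 8: T² + 2`; `5 mod 8: T² + 4`; `7 mod 8: T² − 2`; `1 mod m: Φ_m(T)`. §2.2: "call such a
  polynomial an `E′`-polynomial" — (i) "`g(n)` has a prime divisor `p ≡ a (mod m)` for every large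
  enough integer `n`", (ii) "`g` has no fixed prime divisor from the progression `a mod m`. That
  is, if `p ≡ a (mod m)`, then there is some `n` for which `p` does not divide `g(n)`";
  "THEOREM 1 (assuming Hypothesis H). There is no `E′`-polynomial for the progression `a mod m`
  unless `a² ≡ 1 (mod m)`." "Since Schur has shown that `E`-polynomials exist whenever
  `a² ≡ 1 (mod m)` (cf. [13, Theorem 4]), Murty's impossibility result completes the
  characterization". §3: "let `S(f, m)` denote that subset of `ℤ/mℤ` consisting of those residue
  classes which contain infinitely many prime divisors of `f(T)`. … THEOREM 2. If `f` is
  irreducible over the rational numbers, then `S(f, m)` is a subgroup of `(ℤ/mℤ)ˣ`. In fact, if we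
  form a number field `K` by adjoining a root of `f` to `ℚ`, then Conrad [5] shows that `S(f, m)`
  is exactly the image of `Gal(K(ζ_m)/K)` under the restriction map to `Gal(ℚ(ζ_m)/ℚ)`. The
  impossibility theorem is a straightforward consequence of Theorem 2: Given an `E`-polynomial for
  the progression `a mod m`, it is easy to see that it must have an irreducible factor which is
  also an `E`-polynomial for the same progression. Using `f` to denote this factor, Theorem 2
  implies that `S(f, m)` is a subgroup of `(ℤ/mℤ)ˣ` satisfying
  `{a mod m} ⊂ S(f, m) ⊂ {1 mod m, a mod m}`. This easily implies that `a² ≡ 1 (mod m)`."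
  (Lemma 3: Bunyakovsky's conjecture implies Theorem 2.) §4: Hypothesis H as in the tree; proof
  of Theorem 1 via Lemmas 4–6 and Murty's theorem; Remark 1. §5.1: "we ought not equate Euclidean
  proofs with elementary proofs. [Bang's] arguments … are based not on Euclid's approach to prime
  number theory but on Chebyshev's. Forty years later, similar proofs would be given by Erdős [8]
  and Ricci"; Lucas's argument for `2 mod 5` "is intriguing but erroneous". §5.2: "it not only
  appears difficult to establish unconditionally that there is no `E′`-polynomial for the
  progression `a mod m`, but it is not even obvious how to show that a specific polynomial `f(T)`
  is not an `E′`-polynomial … PROBLEM. Show that `T² + 2` is not an `E′`-polynomial for the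
  progression `2 mod 7`."
* K. Conrad, *Euclidean proofs of Dirichlet's theorem* (expository note)
  [cite: ConradEuclideanDirichlet, p. 1 (definition, Theorems 1–2), Theorem 4 and the derivation of Theorem 2 (pp. 2–4)].
  p. 1: "(We mean by 'Dirichlet's theorem' only the assertion that a congruence class contains
  infinitely many primes, not the stronger assertion about the density of such primes.) … a
  Euclidean proof of Dirichlet's theorem for `a mod m` involves, at the very least, the
  construction of a nonconstant polynomial `h(T) ∈ ℤ[T]` for which any prime factor `p` of any
  integer `h(n)` satisfies, with finitely many exceptions, either `p ≡ 1 mod m` or `p ≡ a mod m`,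
  and infinitely many primes of the latter type occur." "A polynomial `h(T) ∈ ℤ[T]` will be called
  a Euclidean polynomial for `a mod m`, where `(a, m) = 1`, if the prime factors of all `h(n)`, with
  finitely many exceptions, satisfy either `p ≡ 1 mod m` or `p ≡ a mod m`, and infinitely many
  primes of the latter kind occur." "Theorem 1 (Schur, 1912). If `a² ≡ 1 mod m`, then a Euclidean
  polynomial for `a mod m` exists. Theorem 2 (Murty, 1988). If there is a Euclidean polynomial for
  `a mod m`, then `a² ≡ 1 mod m`." p. 2: "The largest `m` such that all units modulo `m` square to
  `1` … is `m = 24`"; "the proof that you can't prove special cases of Dirichlet's theorem in a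
  certain way (à la Euclid) will use a result that is deeper than Dirichlet's theorem itself."
  p. 3: "Theorem 4. For any number field `K`, the subset `S₁(m, K)` of `(ℤ/mℤ)ˣ` is a subgroup. In
  fact, `S₁(m, K)` is the image of `Gal(K(ζ_m)/K) → Gal(ℚ(ζ_m)/ℚ)`" (proof by the Chebotarev
  density theorem for `K(ζ_m)/K`); "For irreducible `h`, with `θ` a root of `h`, `Spl₁(h)` and
  `Spl₁(ℚ(θ))` coincide, with perhaps finitely many exceptions … so `S₁(m, h)` and `S₁(m, ℚ(θ))`
  are equal". p. 4: "if `a mod m` admits a Euclidean polynomial, then it admits an irreducible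
  Euclidean polynomial … Theorem 4 implies `{1, a mod m}` is a group, so `a² ≡ 1 mod m`."
  Epigraph: "It is rash to assert that a mathematical theorem cannot be proved in a particular
  way" (Hardy).
* R. Meštrović, *Euclid's theorem on the infinitude of primes: a historical survey of its proofs*,
  arXiv:1202.3670, §3.2 and Remarks p. 18 [cite: Mestrovic2012Euclid, §3.2 (pp. 16–18)]: the same
  statements of Schur's and Murty's theorems ("This means that it is impossible to prove
  Dirichlet's theorem for certain arithmetic progression by Euclid's method"), the history of
  Euclidean proofs for `±1 mod k`, and "Dirichlet's theorem can be proved by Euclidean's methods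
  for all the possibilities modulo `a = 24`".
* M. R. Murty, N. Thain, *Prime numbers in certain arithmetic progressions*, Funct. Approx.
  Comment. Math. 35 (2006) 249–259 [cite: MurtyThain2006, Theorem 1 (p. 250), §2 definition (p. 251), Theorems 4–6 (pp. 252–254), Theorems 7–8 (pp. 255–256), §4 Theorems 9–11 (pp. 256–258)]
  (read 2026-08-16 from the Project Euclid open PDF; acq-00702 was cite-only). p. 249–250:
  "Murty had shown earlier that such proofs can exist if and only if the residue class (mod `k`)
  has order 1 or 2"; "Theorem 1. (Murty) A 'Euclidean proof' exists for the arithmetic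
  progression `l (mod k)` if and only if `l² ≡ 1 (mod k)`." p. 251: "Thus the most reasonable
  definition of a Euclidean proof for the arithmetic progression `l (mod k)` is the existence of a
  polynomial `f ∈ ℤ[x]` such that all prime divisors of `f` (apart from finitely many) are either
  `≡ 1 (mod k)` or `l (mod k)`. We may also suppose that this polynomial is irreducible" (after
  Theorem 3 (Nagell): `P(f) ∩ P(g)` is infinite, whence "any polynomial has infinitely many prime
  divisors `≡ 1 (mod k)`"). pp. 252–254: Theorem 4 (Schur: for a subgroup `H ≤ (ℤ/kℤ)*` an
  irreducible `f` whose prime divisors lie, with finitely many exceptions, in `H` — the minimal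
  polynomial of a generator `h(ζ)` of the fixed field of `H`), Theorem 5 (conversely every prime in
  `H` divides `f`), Corollary 1 (`Φ_k`: prime divisors `≡ 1 (mod k)` or dividing `k`), Theorem 6
  ("If `l² ≡ 1 (mod k)` then there are infinitely many prime `≡ l (mod k)`, provided there is at
  least one" — the Euclid step via `f(c)` with `c ≡ b (mod p²)`, `c ≡ 0 (mod kQ)`), and the worked
  example `4 (mod 15)` with `f = x⁴ − x³ + 2x² + 1`. p. 255: "Theorem 7. (Murty) Let `f ∈ ℤ[x]`.
  Suppose that with finitely many exceptions, all prime divisors of `f` are either `≡ 1` or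
  `l (mod k)`. Then `l² ≡ 1 (mod k)`" — NOTE: as printed this omits the hypothesis that infinitely
  many prime divisors are `≡ l (mod k)`, which the proof uses ("`ℚ(ζ) ∩ K = H_l` because `K` has, by
  hypothesis infinitely many prime ideals of degree one whose norms are `≡ l (mod k)`"); without it
  the statement is false (`Φ_k` and any `l`: `not_sq_modEq_one_of_restricted_primeDivisors_only`
  below), so the tree's class keeps Pollack's clause (2). p. 255–256: "This fact was first proved by
  the author in [6] … subject to the additional hypothesis that we consider only abelian
  polynomials. Subsequently … normal polynomials. But even this last restriction has been removed";
  "Theorem 8. Let `H` be a subgroup of `(ℤ/kℤ)*`. There is a polynomial `∈ ℤ[x]` such that it has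
  infinitely many prime divisors belonging to a non-trivial residue class of `H`." §4 (pp. 256–258):
  for `K/k` abelian, "a Euclidean proof for `σ ∈ Gal(K/k)` is the existence of a polynomial
  `f ∈ O_k[x]` so that all of the prime divisors of `f` (apart from finitely many) have Frobenius
  element either `1` or `σ`"; Theorem 11: such a proof exists when `σ` has order `2` ("provided
  there is at least 1"); "The work of K. Conrad [3] … shows that no Euclidean proof is possible if
  the order of `σ` is not 2."
* M. R. Murty, J. Madras Univ. B 51 (1988) 161–169 [cite: Murty1988EuclideanAP] — NOT read (not
  reviewed, hard to obtain: Conrad p. 2); its content is reprinted in Murty–Thain (above), Pollack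
  and Conrad. I. Schur, Sitzungsber. Berl. Math. Ges. 11 (1912) 40–50 [cite: Schur1912] — cited as
  reported there (its opening lemma is the tree's `Literature.NumberTheory.Sieve.schur_exists_prime_dvd_eval`;
  Murty–Thain Theorem 2).
* Later Euclidean polynomials, all inside Schur's regime `a² ≡ 1 (mod m)`: X. Lin (2015) for
  `−1 mod k` (Conrad's reference for "`−1 mod d`") [cite: ConradEuclideanDirichlet, p. 1 and ref. [3]] [cite: Lin2015];
  Berktav–Özbudak (2022), explicit Euclidean polynomials for `ℓ ∈ {1, k − 1}`, `k = 8n + 4`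
  [cite: BerktavOzbudak2022, main theorem (zbMATH review)].

## Status of the named facts (2026-08-16): all four are DISCHARGED in sibling files

(which import this one, so they are named here in prose only; axioms checked:
`propext`, `Classical.choice`, `Quot.sound` for each)

* `PrimeDivisorClassesSubgroup_holds`, `EuclideanProofBarrier_holds` —
  `Literature/Barriers/Parity/EuclideanProofsProofs.lean`: Dedekind's criterion for `ℚ[X]/(f)`,
  Frobenius elements of `K(ζ_m)/K`, and the tree's PROVED Chebotarev theorem for cyclotomic
  extensions (`Literature.NumberTheory.GaloisRepresentations.chebotarev_cyclotomicExtension`, from the regularity of ray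
  class `L`-series at `s = 1`), along Murty–Thain's proof of their Theorem 7;
* `Schur1912_euclideanPolynomial_holds` — `Literature/Barriers/Parity/EuclideanProofsSchurProofs.lean`:
  Schur's polynomial `∏_{k ∈ (ℤ/mℤ)ˣ} (T − (1 + ζᵏ)(1 + ζᵃᵏ))` (Murty–Thain Theorems 4–5 with
  `u = −1`), clause (2) by Dirichlet's theorem from Mathlib;
* `Pollack2010_ePrime_holds` — `Literature/Barriers/Parity/EuclideanProofsPollackProofs.lean`:
  Pollack's §4 (Lemmas 4–6, the `H`-step) and Murty's theorem.

## Audit 2026-08-16 (barrier-audit, refuter): CONFIRMED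

* Technique class: the printed theorem quantifies over ALL `f ∈ ℤ[T]` satisfying (2) ∧ (3)
  (Murty–Thain p. 256: the earlier "abelian"/"normal polynomial" restrictions are removed), which is
  exactly `IsEuclideanPolynomial`; the Lean barrier is a THEOREM of the tree
  (`EuclideanProofBarrier_holds`), so no refutation is possible and none of its content rests on a
  vendored fact any more. Clause (2) is load-bearing
  (`not_sq_modEq_one_of_restricted_primeDivisors_only`, proved below: `Φ₅`, `a = 2`, `m = 5`),
  clause (3) is the class itself.
* Transcription checks: "Pollack–Snyder" — Pollack p. 196: "I would like to thank Noah Snyder for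
  proposing the notion of `E′`-polynomials"; the `n → +∞` reading of (i) — Pollack's Lemma 2 takes
  `A > 0` and §4 contradicts (i) along "arbitrarily large positive integer values of `n`", so
  `Pollack2010_ePrime` (stated for `n : ℕ`, a larger class than "all integers `|n|` large") is what
  the printed proof gives.
* Scope: nothing narrower than claimed was found; the number-field generalisation goes the same
  way (Murty–Thain Theorem 11 / Conrad Theorems 4–5: order `≤ 2` only; for non-abelian `E/F` the
  analogue of `S` is the conjugation-closure of a subgroup). Literature sweep (arXiv, zbMATH,
  Crossref, forward citations of Murty–Thain 2006, 2026-08-16): no Euclid-style proof for any class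
  with `a² ≢ 1 (mod m)`; Pollack's Problem (`T² + 2` is not `E′` for `2 mod 7`) found still open.

## Design notes

* Residues are integers `a : ℤ` and congruences are Mathlib's `Int.ModEq` (`[ZMOD m]`), so that
  `−1 mod 4` is written as printed; `m : ℕ` with `0 < m` in the facts ("`m` positive", Pollack).
  Coprimality `(a, m) = 1` is not imposed separately: for `E`-polynomials it follows from clause (2)
  (two distinct primes `≡ a (mod m)` force `gcd(a, m) = 1`); for `E′`-polynomials the non-coprime
  case of `Pollack2010_ePrime` is vacuous too — the only prime `≡ a (mod m)` would be
  `p = gcd(a, m)`, and then (ii) (`p ∤ f(n₀)` for some `n₀`) contradicts (i) along the progression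
  `n ≡ n₀ (mod p)` by periodicity of `f mod p`; and `a² ≡ 1 (mod m)` implies coprimality anyway.
  Both classes are inhabited in the file: `isEuclideanPolynomial_X_neg_one_four` (`T` for
  `−1 mod 4`) and `isEPrimePolynomial_four_X_sub_one` (`4T − 1` for `−1 mod 4`, Table 7.1).
* `IsEuclideanPolynomial` carries `0 < f.natDegree` (Conrad: "nonconstant"); for a non-zero
  constant clause (2) fails by itself, so only `f = 0` is excluded by this conjunct.
* "for every large enough integer `n`" in (i) is rendered as `∀ᶠ n : ℕ in atTop` (`n → +∞`), which
  is exactly what Pollack's proof of Theorem 1 uses (Hypothesis H supplies "arbitrarily large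
  positive integer values of `n`", §4).
* `PrimeDivisorClassesSubgroup` is stated for `f ∈ ℤ[X]` non-constant with `f.map (Int.castRingHom ℚ)`
  irreducible (Pollack: "irreducible over the rational numbers"), as the existence of a subgroup
  `H ≤ (ZMod m)ˣ` whose image in `ZMod m` is `S(f, m)`; the Galois-theoretic identification of `H`
  is quoted, not transcribed.
-/

open Polynomial Filter

namespace Literature.Barriers.Parity

/-! ### Prime divisors of a polynomial and the classes they fill -/

/-- `p` is a *prime divisor of the polynomial* `f ∈ ℤ[T]`: `p` is a prime and `p ∣ f(n)` for some
integer `n`, i.e. `f` has a root modulo `p`. (A non-constant `f` has infinitely many: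
`Literature.NumberTheory.Sieve.schur_exists_prime_dvd_eval`.) [cite: Pollack2010MurtyH, §2.1] -/
def IsPrimeDivisorOf (f : ℤ[X]) (p : ℕ) : Prop :=
  p.Prime ∧ ∃ n : ℤ, (p : ℤ) ∣ f.eval n

/-- Unfolding lemma for `IsPrimeDivisorOf`. [cite: Pollack2010MurtyH, §2.1] -/
theorem isPrimeDivisorOf_iff (f : ℤ[X]) (p : ℕ) :
    IsPrimeDivisorOf f p ↔ p.Prime ∧ ∃ n : ℤ, (p : ℤ) ∣ f.eval n := Iff.rfl

/-- Prime divisors of a factor are prime divisors of the polynomial. [folklore] -/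
theorem IsPrimeDivisorOf.of_dvd {f g : ℤ[X]} (hgf : g ∣ f) {p : ℕ} (h : IsPrimeDivisorOf g p) :
    IsPrimeDivisorOf f p := by
  obtain ⟨hp, n, hn⟩ := h
  exact ⟨hp, n, hn.trans (eval_dvd hgf)⟩

/-- A non-zero constant polynomial has only finitely many prime divisors (the prime factors of the
constant). [folklore] -/
theorem finite_setOf_isPrimeDivisorOf_C {c : ℤ} (hc : c ≠ 0) :
    {p : ℕ | IsPrimeDivisorOf (C c) p}.Finite := by
  refine (Finset.finite_toSet (Nat.divisors c.natAbs)).subset ?_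
  rintro p ⟨hp, n, hn⟩
  rw [eval_C] at hn
  simp only [Finset.mem_coe, Nat.mem_divisors]
  exact ⟨Int.natCast_dvd.mp hn, Int.natAbs_ne_zero.mpr hc⟩

/-- `S(f, m)`: the set of residue classes `mod m` that contain infinitely many prime divisors of
`f` (Pollack's `S(f, m)`, Conrad's `S₁(m, f)`). [cite: Pollack2010MurtyH, §3] [cite: ConradEuclideanDirichlet, p. 2–3 (S₁(m, h))] -/
def primeDivisorClasses (f : ℤ[X]) (m : ℕ) : Set (ZMod m) :=
  {b | {p : ℕ | IsPrimeDivisorOf f p ∧ (p : ZMod m) = b}.Infinite}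

/-- Unfolding lemma for `primeDivisorClasses`. [cite: Pollack2010MurtyH, §3] -/
theorem mem_primeDivisorClasses_iff (f : ℤ[X]) (m : ℕ) (b : ZMod m) :
    b ∈ primeDivisorClasses f m ↔ {p : ℕ | IsPrimeDivisorOf f p ∧ (p : ZMod m) = b}.Infinite :=
  Iff.rfl

/-! ### The technique class: Murty's `E`-polynomials ("Euclidean proofs"), and `E′`-polynomials -/

/-- **Murty's `E`-polynomial (Euclidean polynomial) for the progression `a mod m`** — the
technique class of "Euclidean proofs of Dirichlet's theorem": a non-constant `f ∈ ℤ[T]` such that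
(2) infinitely many prime divisors `p` of `f` satisfy `p ≡ a (mod m)`, and (3) every prime divisor
`p` of `f`, with at most finitely many exceptions, satisfies `p ≡ 1 (mod m)` or `p ≡ a (mod m)`.
"If an `E`-polynomial exists, Murty says that a Euclidean proof exists for the progression
`a mod m`." [cite: Pollack2010MurtyH, §2.1 (2)–(3)] [cite: ConradEuclideanDirichlet, p. 1 (Euclidean polynomial)] -/
def IsEuclideanPolynomial (f : ℤ[X]) (a : ℤ) (m : ℕ) : Prop :=
  0 < f.natDegree ∧
    {p : ℕ | IsPrimeDivisorOf f p ∧ (p : ℤ) ≡ a [ZMOD m]}.Infinite ∧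
    {p : ℕ | IsPrimeDivisorOf f p ∧ ¬((p : ℤ) ≡ 1 [ZMOD m] ∨ (p : ℤ) ≡ a [ZMOD m])}.Finite

/-- **The Pollack–Snyder `E′`-polynomial for `a mod m`** (the widened technique class): (i) `f(n)`
has a prime divisor `p ≡ a (mod m)` for every large enough integer `n` (here: all sufficiently
large `n ∈ ℕ`), and (ii) `f` has no fixed prime divisor from the progression `a mod m` — if
`p ≡ a (mod m)` then `p ∤ f(n)` for some `n`. Given such an `f`, the Euclid-style argument
`n ↦ f(Pn + n₀)`, `P = p₁⋯p_k`, produces a new prime `≡ a (mod m)` at each step.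
[cite: Pollack2010MurtyH, §2.2 (Lemma 1 (i)–(ii) and the definition of E′-polynomial)] -/
def IsEPrimePolynomial (f : ℤ[X]) (a : ℤ) (m : ℕ) : Prop :=
  (∀ᶠ n : ℕ in atTop, ∃ p : ℕ, p.Prime ∧ (p : ℤ) ≡ a [ZMOD m] ∧ (p : ℤ) ∣ f.eval (n : ℤ)) ∧
    ∀ p : ℕ, p.Prime → (p : ℤ) ≡ a [ZMOD m] → ∃ n : ℤ, ¬(p : ℤ) ∣ f.eval n

/-! ### Named facts -/

/-- **Pollack's Theorem 2 / Conrad's Theorem 4 (prime-divisor classes form a subgroup).** For a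
non-constant `f ∈ ℤ[T]` irreducible over `ℚ` and `m ≥ 1`, the set `S(f, m) ⊆ (ℤ/mℤ)ˣ` of classes
containing infinitely many prime divisors of `f` is a SUBGROUP of `(ℤ/mℤ)ˣ` — in fact the image of
`Gal(K(ζ_m)/K)` under restriction to `Gal(ℚ(ζ_m)/ℚ) = (ℤ/mℤ)ˣ`, `K = ℚ(θ)`, `f(θ) = 0` (Chebotarev
density theorem for `K(ζ_m)/K`). Transcribed: there is a subgroup `H ≤ (ZMod m)ˣ` whose image in
`ZMod m` is `S(f, m)`. Mathlib has no Chebotarev density theorem; the tree vendors it over `ℚ` as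
the named fact `Literature.NumberTheory.LFunctions.Chebotarev.dirichletDensity_eq` (`Literature/NumberTheory/LFunctions/ChebotarevDensity.lean`),
the originally intended upstream (Conrad's proof needs Chebotarev for `K(ζ_m)/K` and the bridge
`Spl₁(f) = Spl₁(ℚ(θ))` up to finitely many primes). Recorded as a named fact; DISCHARGED since:
`PrimeDivisorClassesSubgroup_holds` in `Literature/Barriers/Parity/EuclideanProofsProofs.lean`
(Dedekind for `ℚ[X]/(f)` + the tree's proved Chebotarev theorem for cyclotomic extensions
`Literature.NumberTheory.GaloisRepresentations.chebotarev_cyclotomicExtension`).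
(Pollack's Lemma 3 derives the subgroup property from Bunyakovsky's conjecture instead.)
[cite: Pollack2010MurtyH, §3 Theorem 2] [cite: ConradEuclideanDirichlet, Theorem 4] [cite: MurtyThain2006, §3 (proof of Theorem 7, p. 255)] -/
def PrimeDivisorClassesSubgroup : Prop :=
  ∀ (m : ℕ) (f : ℤ[X]), 0 < m → 0 < f.natDegree → Irreducible (f.map (Int.castRingHom ℚ)) →
    ∃ H : Subgroup (ZMod m)ˣ,
      primeDivisorClasses f m = ((↑) : (ZMod m)ˣ → ZMod m) '' (H : Set (ZMod m)ˣ)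

/-- **Murty's impossibility theorem for Euclidean proofs of Dirichlet's theorem** (Murty 1988;
Murty–Thain 2006; as printed by Pollack 2010 and Conrad): there is no `E`-polynomial for the
progression `a mod m` unless `a² ≡ 1 (mod m)` — "For example, there is no Euclidean proof that
there are infinitely many primes `p ≡ 2 (mod 5)`." PROVED below from `PrimeDivisorClassesSubgroup`
(`euclideanProofBarrier_of_subgroup`), following the printed deduction.
[cite: Pollack2010MurtyH, §1.1 and §2.1 (Murty's impossibility theorem)] [cite: ConradEuclideanDirichlet, Theorem 2] [cite: Murty1988EuclideanAP] [cite: MurtyThain2006, Theorem 1 (p. 250) and Theorem 7 (p. 255)] [cite: Mestrovic2012Euclid, §3.2 Remarks p. 18]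

BARRIER (D-0021; one line per key):
technique_class: euclidean-proofs elementary-euclid-style polynomial-prime-divisors restricted-prime-divisor-polynomials — Murty's `E`-polynomials `IsEuclideanPolynomial f a m` (a non-constant `f ∈ ℤ[T]` whose prime divisors lie, with finitely many exceptions, in the classes `1` and `a (mod m)` and meet `a (mod m)` infinitely often: "If an `E`-polynomial exists, Murty says that a Euclidean proof exists") and, conditionally, the Pollack–Snyder `E′`-polynomials `IsEPrimePolynomial f a m` [cite: Pollack2010MurtyH, §2.1–2.2] [cite: ConradEuclideanDirichlet, p. 1].
blocks: a Euclidean proof (exhibiting an `E`-polynomial) of Dirichlet's theorem — the qualitative content of the degree-one, one-polynomial case `f = mT + a` of Bunyakovsky / Bateman–Horn (`Literature.NumberTheory.Sieve.BunyakovskyConjecture`, `Literature.NumberTheory.Sieve.BatemanHornConjecture`, `Literature.NumberTheory.Sieve.DicksonConjecture` with `k = 1`) — for every progression `a mod m` with `a² ≢ 1 (mod m)`, e.g. `2 mod 5` or `7 mod 10`; since `24` is the largest modulus all of whose units square to `1`, for every `m ∤ 24` some class is out of reach [cite: Pollack2010MurtyH, §1.1] [cite: ConradEuclideanDirichlet,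 Theorem 2 and p. 2]; ASSUMING Hypothesis H (`Literature.NumberTheory.Sieve.SchinzelHypothesisH`), also any proof exhibiting an `E′`-polynomial (`Pollack2010_ePrime`) [cite: Pollack2010MurtyH, Theorem 1].
because: for `f` non-constant and irreducible over `ℚ`, the set `S(f, m)` of classes `mod m` containing infinitely many prime divisors of `f` is a subgroup of `(ℤ/mℤ)ˣ` — the image of `Gal(K(ζ_m)/K) → Gal(ℚ(ζ_m)/ℚ)`, `K = ℚ(θ)`, `f(θ) = 0`, by the Chebotarev density theorem (`PrimeDivisorClassesSubgroup`) [cite: ConradEuclideanDirichlet, Theorem 4] [cite: Pollack2010MurtyH, Theorem 2]; an `E`-polynomial has an irreducible factor that is again an `E`-polynomial (pigeonhole), for which `{a} ⊆ S(f, m) ⊆ {1, a}`, and a subgroup sandwiched like this forces `a² ∈ {1, a}`, i.e. `a² ≡ 1 (mod m)` (`euclideanProofBarrier_of_subgroup`, proved) [cite: Pollack2010MurtyH, §3] [cite: ConradEuclideanDirichlet, p. 4] [cite: MurtyThain2006, Theorem 7 (p. 255; proof via Bauer's theorem and Chebotarev)]; under Hypothesis H an `E′`-polynomial is divisible by an `E`-polynomial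 for the same progression, so Murty's theorem transfers [cite: Pollack2010MurtyH, §4 and Remark 1].
evasions_known: when `a² ≡ 1 (mod m)` Euclidean polynomials EXIST (Schur 1912; `Schur1912_euclideanPolynomial`), e.g. `T` for `−1 mod 4`, `T² + 1` for `1 mod 4`, `T² + 2` for `3 mod 8`, `Φ_m(T)` for `1 mod m`, `x⁴ − x³ + 2x² + 1` for `4 mod 15`, and for all classes `mod 24` (Bateman–Low 1965) [cite: Pollack2010MurtyH, §1.1, §2.2 and Table 7.1] [cite: ConradEuclideanDirichlet, Theorem 1] [cite: MurtyThain2006, Theorems 4–6 and the example 4 (mod 15) (pp. 252–255)] [cite: BatemanLow1965] — later explicit constructions stay inside this regime (Lin 2015, `−1 mod k`; Berktav–Özbudak 2022, `±1 mod 8n + 4`) [cite: Lin2015] [cite: BerktavOzbudak2022, main theorem (zbMATH review)]; Mathlib's `Nat.exists_prime_gt_modEq_one` (via cyclotomic polynomials) is a proof of this kind for `1 mod m`; Euclid's method does reach UNIONS of classes — "a polynomial … has infinitely many prime divisors belonging to a non-trivial residue class of `H`" for every subgroup `H` [cite: MurtyThain2006, Theorem 8 (p. 256)] — and, over a number field `k`,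 every Frobenius element of ORDER 2 of an abelian `K/k` [cite: MurtyThain2006, Theorem 11 (p. 257)]; "we ought not equate Euclidean proofs with elementary proofs": Bang (1891, 1937), Erdős (1935) and Ricci (1933–34) treat many further progressions by Chebyshev's method, and Selberg (1949), Zassenhaus (1949), Shapiro (1950) prove the full theorem with minimal analysis [cite: Pollack2010MurtyH, §1.1 and §5.1]; Dirichlet's analytic proof covers every coprime class (Mathlib `Nat.infinite_setOf_prime_and_eq_mod`, used in `isEuclideanPolynomial_X_neg_one_four`) [cite: Pollack2010MurtyH, §1.1 (Dirichlet's theorem)].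
scope_caveats: the theorem is relative to Murty's DEFINITION of a Euclidean proof (conditions (2) ∧ (3) on one polynomial in one variable over `ℤ`); clause (2) cannot be dropped — Murty–Thain's Theorem 7 as printed omits it, but its proof uses it and `Φ₅`, `a = 2 (mod 5)` satisfies (3) alone (`not_sq_modEq_one_of_restricted_primeDivisors_only`, proved here) [cite: MurtyThain2006, Theorem 7 and its proof (p. 255)]; for the wider `E′`-polynomials the impossibility is proved only under Hypothesis H — equivalently, an `E′`-polynomial for a class with `a² ≢ 1 (mod m)` would REFUTE `Literature.NumberTheory.Sieve.SchinzelHypothesisH` (contrapositive of `Pollack2010_ePrime`), so inside a programme aiming at Hypothesis H / Bateman–Horn that route is inconsistent with the target rather than merely blocked [cite: Pollack2010MurtyH, Theorem 1] — and unconditionally "it is not even obvious how to show that a specific polynomial `f(T)` is not an `E′`-polynomial" (open Problem: `T² + 2` for `2 mod 7`; Lenstra's and Coppersmith's arguments settle `T² + 1`, `T² + 2` for `2 mod 5`; no solution found in the literature as of 2026-08-16) [cite: Pollack2010MurtyH, §5.2]; lifting to number fields does not help: for abelian `K/k` Euclidean proofs exist exactly for Frobenius elements of order `≤ 2`, and for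 non-abelian `E/F` the analogue of `S` is the conjugation-closure of a subgroup, "it has no right to be a group" [cite: MurtyThain2006, §4 (Theorem 11 and the closing paragraph, p. 258)] [cite: ConradEuclideanDirichlet, Theorems 4–5 (pp. 3–5)] (remark, this file: since `Frob_𝔭 = Frob_p^{f(𝔭|p)}` on `ℚ(ζ_m)`, a class `a` of order `r > 2` cannot be isolated through an order-`≤ 2` element `a^f` upstairs — `r ∣ 2f` forces `gcd(f, r) > 1`, and then the whole coset `a·⟨a^{r/gcd(f,r)}⟩` has the same `f`-th power); it does not assert that Dirichlet's theorem lacks elementary proofs [cite: Pollack2010MurtyH, §5.1], and it concerns only the infinitude of primes in a class, "not the stronger assertion about the density of such primes" [cite: ConradEuclideanDirichlet, p. 1] — nothing is claimed about quantitative Bateman–Horn or about polynomials of degree `≥ 2`; the Galois-theoretic description of `S(f, m)` is quoted but only "`S(f, m)` is the image of a subgroup" is transcribed, as a named fact (Chebotarev is not in Mathlib) [cite: ConradEuclideanDirichlet, Theorem 4]; Murty (1988) itself was not read — statements as reprinted by Murty–Thain (read), Pollack and Conrad [cite: MurtyThain2006, Theorems 1 and 7] [cite: Pollack2010MurtyH,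 §2.1] [cite: ConradEuclideanDirichlet, Theorems 1–2].
status: theorem (established; proved in the tree: `EuclideanProofBarrier_holds` in `EuclideanProofsProofs.lean`, from the proved Chebotarev theorem for `K(ζ_m)/K`; the companion facts `PrimeDivisorClassesSubgroup_holds`, `Schur1912_euclideanPolynomial_holds`, `Pollack2010_ePrime_holds` likewise; audited 2026-08-16: confirmed, no narrowing) [cite: MurtyThain2006, Theorem 1 (p. 250)] [cite: Pollack2010MurtyH, §2.1] -/
def EuclideanProofBarrier : Prop :=
  ∀ (m : ℕ) (a : ℤ) (f : ℤ[X]), 0 < m → IsEuclideanPolynomial f a m → a ^ 2 ≡ 1 [ZMOD m]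

/-- **Schur's existence theorem** (1912; Murty–Thain 2006, Theorem 4 as cited by Pollack; Conrad,
Theorem 1): if `a² ≡ 1 (mod m)` (`m ≥ 1`), an `E`-polynomial for `a mod m` exists. Named fact
(Schur's construction uses the minimal polynomial of a suitable Gaussian period / quadratic
reciprocity; not in Mathlib); DISCHARGED since: `Schur1912_euclideanPolynomial_holds` in
`Literature/Barriers/Parity/EuclideanProofsSchurProofs.lean` (Schur's polynomial
`∏_{k ∈ (ℤ/mℤ)ˣ} (T − (1 + ζᵏ)(1 + ζᵃᵏ))`, Murty–Thain Theorems 4–5 with `u = −1`).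
[cite: ConradEuclideanDirichlet, Theorem 1] [cite: Pollack2010MurtyH, §2.2 ("Schur has shown that E-polynomials exist whenever a² ≡ 1 (mod m)")] [cite: MurtyThain2006, Theorems 4–6 (pp. 252–254)] [cite: Schur1912] -/
def Schur1912_euclideanPolynomial : Prop :=
  ∀ (m : ℕ) (a : ℤ), 0 < m → a ^ 2 ≡ 1 [ZMOD m] → ∃ f : ℤ[X], IsEuclideanPolynomial f a m

/-- **Pollack 2010, Theorem 1 (assuming Hypothesis H).** Under Schinzel's Hypothesis H
(`Literature.NumberTheory.Sieve.SchinzelHypothesisH`), there is no `E′`-polynomial for the progression `a mod m`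
unless `a² ≡ 1 (mod m)`. Stated as the implication, which is what is proved in print (via
Lemmas 4–6 and Murty's theorem; Lemma 2 takes `A > 0` and §4 contradicts (i) along "arbitrarily
large positive integer values of `n`", which is why (i) is rendered for `n → +∞`); DISCHARGED
since: `Pollack2010_ePrime_holds` in `Literature/Barriers/Parity/EuclideanProofsPollackProofs.lean`.
Read contrapositively: an `E′`-polynomial for a class with `a² ≢ 1 (mod m)` refutes Hypothesis H.
[cite: Pollack2010MurtyH, Theorem 1 and §4 (Lemma 2, Lemmas 4–6)] -/
def Pollack2010_ePrime : Prop :=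
  Literature.NumberTheory.Sieve.SchinzelHypothesisH →
    ∀ (m : ℕ) (a : ℤ) (f : ℤ[X]), 0 < m → IsEPrimePolynomial f a m → a ^ 2 ≡ 1 [ZMOD m]

/-! ### Proof of Murty's theorem from the subgroup fact -/

namespace IsEuclideanPolynomial

variable {f : ℤ[X]} {a : ℤ} {m : ℕ}

/-- An `E`-polynomial is non-zero. [cite: Pollack2010MurtyH, §2.1] -/
theorem ne_zero (h : IsEuclideanPolynomial f a m) : f ≠ 0 := by
  rintro rfl
  simp [IsEuclideanPolynomial] at h

/-- Clause (3) passes to factors: a factor of an `E`-polynomial with infinitely many prime divisors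
`≡ a (mod m)` and positive degree is an `E`-polynomial. [cite: Pollack2010MurtyH, §3] -/
theorem of_dvd (h : IsEuclideanPolynomial f a m) {g : ℤ[X]} (hgf : g ∣ f) (hg : 0 < g.natDegree)
    (hinf : {p : ℕ | IsPrimeDivisorOf g p ∧ (p : ℤ) ≡ a [ZMOD m]}.Infinite) :
    IsEuclideanPolynomial g a m := by
  refine ⟨hg, hinf, h.2.2.subset ?_⟩
  rintro p ⟨hpg, hp⟩
  exact ⟨hpg.of_dvd hgf, hp⟩

/-- Every prime divisor of `f ≠ 0` is a prime divisor of one of its irreducible factors (in the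
UFD `ℤ[X]`; the unit is `±1`). [folklore] -/
theorem exists_mem_factors_isPrimeDivisorOf {f : ℤ[X]} (hf : f ≠ 0) {p : ℕ}
    (hp : IsPrimeDivisorOf f p) :
    ∃ g ∈ UniqueFactorizationMonoid.factors f, IsPrimeDivisorOf g p := by
  classical
  obtain ⟨hpp, n, hn⟩ := hp
  obtain ⟨u, hu⟩ := UniqueFactorizationMonoid.factors_prod hf
  have hpZ : Prime (p : ℤ) := Nat.prime_iff_prime_int.mp hpp
  rw [← hu, eval_mul] at hn
  -- the unit evaluates to a unit of `ℤ`
  obtain ⟨r, hr, hru⟩ := Polynomial.isUnit_iff.mp (Units.isUnit u)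
  rw [← hru, eval_C] at hn
  have hn' : (p : ℤ) ∣ eval n (UniqueFactorizationMonoid.factors f).prod := by
    refine (hpZ.dvd_or_dvd hn).resolve_right fun hd => hpZ.not_unit ?_
    exact isUnit_of_dvd_one (hd.trans hr.dvd)
  rw [eval_multiset_prod] at hn'
  obtain ⟨x, hx, hpx⟩ := hpZ.exists_mem_multiset_dvd hn'
  obtain ⟨g, hg, rfl⟩ := Multiset.mem_map.mp hx
  exact ⟨g, hg, hpp, n, hpx⟩

/-- **An `E`-polynomial has an irreducible factor which is an `E`-polynomial** ("it is easy to
see", Pollack; "by the pigeonhole principle", Conrad). [cite: Pollack2010MurtyH, §3] [cite: ConradEuclideanDirichlet, p. 4] -/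
theorem exists_irreducible (h : IsEuclideanPolynomial f a m) :
    ∃ g : ℤ[X], Irreducible g ∧ g ∣ f ∧ IsEuclideanPolynomial g a m := by
  classical
  have hf := h.ne_zero
  set s := UniqueFactorizationMonoid.factors f with hs
  -- pigeonhole: some factor carries infinitely many prime divisors `≡ a`
  have hex : ∃ g ∈ s, {p : ℕ | IsPrimeDivisorOf g p ∧ (p : ℤ) ≡ a [ZMOD m]}.Infinite := by
    by_contra hall
    push Not at hall
    have hfin : (⋃ g ∈ (s.toFinset : Set ℤ[X]),
        {p : ℕ | IsPrimeDivisorOf g p ∧ (p : ℤ) ≡ a [ZMOD m]}).Finite :=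
      Set.Finite.biUnion s.toFinset.finite_toSet fun g hg =>
        hall g (Multiset.mem_toFinset.mp hg)
    refine h.2.1 (hfin.subset ?_)
    rintro p ⟨hpf, hpa⟩
    obtain ⟨g, hg, hpg⟩ := exists_mem_factors_isPrimeDivisorOf hf hpf
    simp only [Set.mem_iUnion, Set.mem_setOf_eq, Finset.mem_coe, Multiset.mem_toFinset]
    exact ⟨g, hg, hpg, hpa⟩
  obtain ⟨g, hg, hinf⟩ := hex
  have hirr : Irreducible g := UniqueFactorizationMonoid.irreducible_of_factor g hg
  have hgf : g ∣ f := UniqueFactorizationMonoid.dvd_of_mem_factors hg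
  -- `g` is not constant: a non-zero constant has finitely many prime divisors
  have hdeg : 0 < g.natDegree := by
    by_contra h0
    push Not at h0
    have h0' : g.natDegree = 0 := Nat.le_zero.mp h0
    have hgC : g = C (g.coeff 0) := eq_C_of_natDegree_eq_zero h0'
    have hc : g.coeff 0 ≠ 0 := by
      intro hc
      apply hirr.ne_zero
      rw [hgC, hc, C_0]
    refine hinf ((finite_setOf_isPrimeDivisorOf_C hc).subset ?_)
    rintro p ⟨hpg, -⟩
    simpa [← hgC] using hpg
  exact ⟨g, hirr, hgf, h.of_dvd hgf hdeg hinf⟩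

end IsEuclideanPolynomial

/-- The classes filled by an `E`-polynomial: `a ∈ S(f, m)` and `S(f, m) ⊆ {1, a}`.
[cite: Pollack2010MurtyH, §3] -/
theorem IsEuclideanPolynomial.primeDivisorClasses_sandwich {f : ℤ[X]} {a : ℤ} {m : ℕ}
    (h : IsEuclideanPolynomial f a m) :
    ((a : ZMod m) ∈ primeDivisorClasses f m) ∧
      primeDivisorClasses f m ⊆ {1, (a : ZMod m)} := by
  constructor
  · show Set.Infinite _
    refine h.2.1.mono ?_
    rintro p ⟨hpd, hpa⟩
    refine ⟨hpd, ?_⟩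
    have := (ZMod.intCast_eq_intCast_iff (p : ℤ) a m).mpr hpa
    simpa using this
  · intro b hb
    have hb' : {p : ℕ | IsPrimeDivisorOf f p ∧ (p : ZMod m) = b}.Infinite := hb
    obtain ⟨p, ⟨hpd, hpb⟩, hpE⟩ := (hb'.sdiff h.2.2).nonempty
    have hp1a : (p : ℤ) ≡ 1 [ZMOD m] ∨ (p : ℤ) ≡ a [ZMOD m] := by
      by_contra hno
      exact hpE ⟨hpd, hno⟩
    rcases hp1a with hp1 | hpa
    · left
      have := (ZMod.intCast_eq_intCast_iff (p : ℤ) 1 m).mpr hp1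
      rw [← hpb]
      simpa using this
    · right
      have := (ZMod.intCast_eq_intCast_iff (p : ℤ) a m).mpr hpa
      rw [Set.mem_singleton_iff, ← hpb]
      simpa using this

/-- The group-theoretic step: a subgroup `H ≤ (ℤ/mℤ)ˣ` whose image `S` satisfies
`{a} ⊆ S ⊆ {1, a}` forces `a² = 1`. [cite: Pollack2010MurtyH, §3 ("This easily implies that a² ≡ 1 (mod m)")] -/
theorem sq_eq_one_of_subgroup_sandwich {m : ℕ} (H : Subgroup (ZMod m)ˣ) {a : ZMod m}
    (ha : a ∈ ((↑) : (ZMod m)ˣ → ZMod m) '' (H : Set (ZMod m)ˣ))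
    (hsub : ((↑) : (ZMod m)ˣ → ZMod m) '' (H : Set (ZMod m)ˣ) ⊆ {1, a}) : a ^ 2 = 1 := by
  obtain ⟨u, hu, rfl⟩ := ha
  have hu2 : u * u ∈ H := H.mul_mem hu hu
  have hmem : ((u * u : (ZMod m)ˣ) : ZMod m) ∈ ({1, (u : ZMod m)} : Set (ZMod m)) :=
    hsub ⟨u * u, hu2, rfl⟩
  rw [sq]
  rcases hmem with h1 | h2
  · simpa using h1
  · -- `u² = u` in the unit group forces `u = 1`
    rw [Set.mem_singleton_iff, Units.val_mul] at h2
    have hu1 : (u : ZMod m) = 1 := by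
      have h3 : ((u * u : (ZMod m)ˣ) : ZMod m) = (u * 1 : (ZMod m)ˣ) := by simpa using h2
      have h4 : u * u = u * 1 := Units.ext h3
      have h5 : u = 1 := mul_left_cancel h4
      simp [h5]
    simp [hu1]

/-- **Murty's impossibility theorem, PROVED from the subgroup fact** (Pollack's Theorem 2 /
Conrad's Theorem 4): an `E`-polynomial for `a mod m` forces `a² ≡ 1 (mod m)`. The deduction is the
printed one: pass to an irreducible `E`-polynomial factor `g` (Gauss's lemma makes it irreducible
over `ℚ`), observe `{a} ⊆ S(g, m) ⊆ {1, a}`, and use that `S(g, m)` is a group.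
[cite: Pollack2010MurtyH, §3] [cite: ConradEuclideanDirichlet, p. 4] -/
theorem euclideanProofBarrier_of_subgroup (hS : PrimeDivisorClassesSubgroup) :
    EuclideanProofBarrier := by
  intro m a f hm hf
  obtain ⟨g, hgirr, -, hg⟩ := hf.exists_irreducible
  have hprim : g.IsPrimitive := hgirr.isPrimitive hg.1.ne'
  have hgQ : Irreducible (g.map (Int.castRingHom ℚ)) :=
    (IsPrimitive.Int.irreducible_iff_irreducible_map_cast hprim).mp hgirr
  obtain ⟨H, hH⟩ := hS m g hm hg.1 hgQ
  obtain ⟨haS, hsub⟩ := hg.primeDivisorClasses_sandwich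
  rw [hH] at haS hsub
  have hsq : ((a : ZMod m)) ^ 2 = 1 := sq_eq_one_of_subgroup_sandwich H haS hsub
  have : ((a ^ 2 : ℤ) : ZMod m) = ((1 : ℤ) : ZMod m) := by push_cast; exact hsq
  exact (ZMod.intCast_eq_intCast_iff _ _ _).mp this

/-- The barrier in the form "no `E`-polynomial": if `a² ≢ 1 (mod m)` then `a mod m` has no
Euclidean polynomial — e.g. `2 mod 5` (`2² = 4 ≢ 1`). [cite: Pollack2010MurtyH, §1.1] -/
theorem EuclideanProofBarrier.not_isEuclideanPolynomial (h : EuclideanProofBarrier) {m : ℕ}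
    (hm : 0 < m) {a : ℤ} (ha : ¬ a ^ 2 ≡ 1 [ZMOD m]) (f : ℤ[X]) :
    ¬ IsEuclideanPolynomial f a m :=
  fun hf => ha (h m a f hm hf)

/-- The printed example: no Euclidean proof for `2 mod 5` (modulo the named fact).
[cite: Pollack2010MurtyH, §1.1] [cite: ConradEuclideanDirichlet, p. 2] -/
theorem EuclideanProofBarrier.two_mod_five (h : EuclideanProofBarrier) (f : ℤ[X]) :
    ¬ IsEuclideanPolynomial f 2 5 :=
  h.not_isEuclideanPolynomial (by norm_num) (by decide) f

/-! ### Non-vacuity of the technique class: `T` is an `E`-polynomial for `−1 mod 4` -/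

/-- Every prime is a prime divisor of `T` (it divides `T(0) = 0`, indeed `T(p) = p`). [folklore] -/
theorem isPrimeDivisorOf_X {p : ℕ} (hp : p.Prime) : IsPrimeDivisorOf X p :=
  ⟨hp, p, by simp⟩

/-- An odd prime is `≡ 1` or `≡ −1 (mod 4)`. [folklore] -/
theorem prime_modEq_one_or_neg_one_four {p : ℕ} (hp : p.Prime) (hp2 : p ≠ 2) :
    (p : ℤ) ≡ 1 [ZMOD 4] ∨ (p : ℤ) ≡ -1 [ZMOD 4] := by
  have hodd : p % 2 = 1 := (hp.eq_two_or_odd).resolve_left hp2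
  have h4 : (p : ℤ) % 4 = 1 ∨ (p : ℤ) % 4 = 3 := by omega
  rcases h4 with h | h
  · left
    show (p : ℤ) % 4 = 1 % 4
    rw [h]; norm_num
  · right
    show (p : ℤ) % 4 = (-1) % 4
    rw [h]; norm_num

/-- **`T` is an `E`-polynomial for the progression `−1 mod 4`** (Pollack's Table 7.1, first row):
its prime divisors are all primes, those `≡ −1 (mod 4)` are infinite in number (here by Mathlib's
Dirichlet theorem; Euclid-style: a prime factor `≡ 3 (mod 4)` of `4p₁⋯p_k − 1`), and the only
prime divisor outside `{1, −1 mod 4}` is `2`. So the technique class is inhabited, consistently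
with `(−1)² ≡ 1 (mod 4)`. [cite: Pollack2010MurtyH, Table 7.1 and §1.1 (the proof for 3 mod 4)] -/
theorem isEuclideanPolynomial_X_neg_one_four : IsEuclideanPolynomial X (-1) 4 := by
  refine ⟨by simp, ?_, ?_⟩
  · -- infinitely many prime divisors `≡ −1 (mod 4)`
    have hD := Nat.infinite_setOf_prime_and_eq_mod (q := 4) (a := -1) isUnit_one.neg
    refine hD.mono ?_
    rintro p ⟨hp, hpm⟩
    refine ⟨isPrimeDivisorOf_X hp, ?_⟩
    have : ((p : ℤ) : ZMod 4) = ((-1 : ℤ) : ZMod 4) := by simpa using hpm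
    exact (ZMod.intCast_eq_intCast_iff _ _ _).mp this
  · -- the exceptional prime divisors are contained in `{2}`
    refine (Set.finite_singleton 2).subset ?_
    rintro p ⟨⟨hp, -⟩, hno⟩
    by_contra hp2
    exact hno (prime_modEq_one_or_neg_one_four hp hp2)

/-! ### Non-vacuity of the widened class: `4T − 1` is an `E′`-polynomial for `−1 mod 4` -/

/-- A natural number all of whose prime factors are `≡ 1 (mod 4)` is itself `≡ 1 (mod 4)`.
[folklore] -/
theorem cast_zmod_four_eq_one_of_primeFactors {N : ℕ} (hN : N ≠ 0)
    (h : ∀ p ∈ N.primeFactorsList, (p : ZMod 4) = 1) : (N : ZMod 4) = 1 := by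
  rw [← Nat.prod_primeFactorsList hN, Nat.cast_list_prod]
  refine List.prod_eq_one fun x hx => ?_
  obtain ⟨p, hp, rfl⟩ := List.mem_map.mp hx
  exact h p hp

/-- Every `4n − 1` (`n ≥ 1`) has a prime factor `≡ −1 (mod 4)` (the step in Euclid's proof for
`3 mod 4`). [cite: Pollack2010MurtyH, §1.1 (the proof for the progression 3 mod 4)] -/
theorem exists_prime_factor_neg_one_mod_four {n : ℕ} (hn : 1 ≤ n) :
    ∃ p : ℕ, p.Prime ∧ (p : ℤ) ≡ -1 [ZMOD 4] ∧ p ∣ 4 * n - 1 := by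
  set N := 4 * n - 1 with hN
  have hN0 : N ≠ 0 := by omega
  have hN3 : (N : ZMod 4) = 3 := by
    have : N = 4 * (n - 1) + 3 := by omega
    rw [this]; push_cast
    have h4 : (4 : ZMod 4) = 0 := by decide
    rw [h4]; ring
  -- not all prime factors are `≡ 1 (mod 4)`
  have hnot : ¬ ∀ p ∈ N.primeFactorsList, (p : ZMod 4) = 1 := by
    intro hall
    have := cast_zmod_four_eq_one_of_primeFactors hN0 hall
    rw [hN3] at this
    exact absurd this (by decide)
  push Not at hnot
  obtain ⟨p, hp, hp1⟩ := hnot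
  have hpp : p.Prime := Nat.prime_of_mem_primeFactorsList hp
  have hpN : p ∣ N := Nat.dvd_of_mem_primeFactorsList hp
  refine ⟨p, hpp, ?_, hpN⟩
  -- `p` is odd (it divides the odd number `N`), hence `≡ 1` or `≡ −1 (mod 4)`; not `1`, so `−1`
  have hp2 : p ≠ 2 := by
    rintro rfl
    have : (2 : ℕ) ∣ N := hpN
    omega
  rcases prime_modEq_one_or_neg_one_four hpp hp2 with h1 | h3
  · exfalso
    apply hp1
    have := (ZMod.intCast_eq_intCast_iff (p : ℤ) 1 4).mpr h1
    simpa using this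
  · exact h3

/-- **`4T − 1` is an `E′`-polynomial for the progression `−1 mod 4`** (Pollack's Table 7.1, first
row): (i) for every `n ≥ 1`, `4n − 1` has a prime factor `≡ −1 (mod 4)`; (ii) no prime `≡ −1 (mod 4)`
divides `f(0) = −1`. So the class in `Pollack2010_ePrime` is inhabited, consistently with
`(−1)² ≡ 1 (mod 4)`. [cite: Pollack2010MurtyH, Table 7.1 and §2.2] -/
theorem isEPrimePolynomial_four_X_sub_one : IsEPrimePolynomial (4 * X - 1) (-1) 4 := by
  constructor
  · filter_upwards [eventually_ge_atTop 1] with n hn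
    obtain ⟨p, hp, hpm, hpd⟩ := exists_prime_factor_neg_one_mod_four hn
    refine ⟨p, hp, hpm, ?_⟩
    have heval : (4 * X - 1 : ℤ[X]).eval (n : ℤ) = ((4 * n - 1 : ℕ) : ℤ) := by
      have h1 : 1 ≤ 4 * n := by omega
      simp [Nat.cast_sub h1]
    rw [heval]
    exact Int.natCast_dvd_natCast.mpr hpd
  · intro p hp _
    refine ⟨0, ?_⟩
    have heval : (4 * X - 1 : ℤ[X]).eval 0 = -1 := by simp
    rw [heval, Int.dvd_neg, Int.natCast_dvd_ofNat]
    exact hp.one_lt.ne' ∘ Nat.dvd_one.mp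

/-! ### Audit 2026-08-16: clause (2) of Murty's definition is load-bearing

Murty–Thain print their Theorem 7 with the restriction clause (3) alone; their proof uses clause
(2) ("`K` has, by hypothesis infinitely many prime ideals of degree one whose norms are
`≡ l (mod k)`", p. 255).  The cyclotomic polynomial shows that (3) alone does not force
`a² ≡ 1 (mod m)`: all prime divisors of `Φ_m` not dividing `m` are `≡ 1 (mod m)` (Murty–Thain,
Corollary 1; Pollack, Table 7.1, last row), so `Φ₅` satisfies (3) for the class `2 mod 5` while
`2² ≢ 1 (mod 5)`.  Hence the barrier statement with (2) dropped is FALSE, i.e. any proof of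
`EuclideanProofBarrier` must use clause (2) — as `euclideanProofBarrier_of_subgroup` does, through
`a ∈ S(f, m)`. -/

/-- Prime divisors of the cyclotomic polynomial `Φₙ` (`n ≥ 1`) that do not divide `n` are
`≡ 1 (mod n)`: a root of `Φₙ` modulo `p ∤ n` is a primitive `n`-th root of unity in `𝔽_p`, so
`n ∣ p − 1`. [cite: MurtyThain2006, Corollary 1 (p. 253)] [cite: Pollack2010MurtyH, Table 7.1 (Φ_m(T) for 1 mod m)] -/
theorem modEq_one_of_isPrimeDivisorOf_cyclotomic {n p : ℕ} (hn : 0 < n)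
    (hp : IsPrimeDivisorOf (cyclotomic n ℤ) p) (hpn : ¬ p ∣ n) : (p : ℤ) ≡ 1 [ZMOD n] := by
  obtain ⟨hpp, k, hk⟩ := hp
  haveI := Fact.mk hpp
  -- `k` is a root of `Φₙ` modulo `p`
  have hroot : IsRoot (cyclotomic n (ZMod p)) ((k : ℤ) : ZMod p) := by
    rw [IsRoot.def, ← map_cyclotomic_int n (ZMod p), eval_intCast_map, Int.coe_castRingHom,
      ZMod.intCast_zmod_eq_zero_iff_dvd]
    exact hk
  haveI : NeZero ((n : ℕ) : ZMod p) := by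
    refine ⟨?_⟩
    rw [Ne, ZMod.natCast_eq_zero_iff]
    exact hpn
  have hprim : IsPrimitiveRoot ((k : ℤ) : ZMod p) n := isRoot_cyclotomic_iff.mp hroot
  have hk0 : ((k : ℤ) : ZMod p) ≠ 0 := hprim.ne_zero hn.ne'
  have hord : orderOf ((k : ℤ) : ZMod p) = n := hprim.eq_orderOf.symm
  have hdvd : n ∣ p - 1 := hord ▸ ZMod.orderOf_dvd_card_sub_one hk0
  have h1p : 1 ≤ p := hpp.one_lt.le
  have hdvdZ : (n : ℤ) ∣ (p : ℤ) - 1 := by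
    have := Int.natCast_dvd_natCast.mpr hdvd
    simpa [Nat.cast_sub h1p] using this
  exact (Int.modEq_iff_dvd.mpr hdvdZ).symm

/-- The exceptional prime divisors of `Φₙ` (those not `≡ 1 (mod n)`) divide `n`; in particular they
form a finite set — clause (3) for `Φₙ` and ANY class `a mod n`. [cite: MurtyThain2006, Corollary 1 and the remark after it (p. 253)] -/
theorem finite_isPrimeDivisorOf_cyclotomic_not_modEq_one {n : ℕ} (hn : 0 < n) :
    {p : ℕ | IsPrimeDivisorOf (cyclotomic n ℤ) p ∧ ¬ (p : ℤ) ≡ 1 [ZMOD n]}.Finite := by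
  refine (Finset.finite_toSet (Nat.divisors n)).subset ?_
  rintro p ⟨hp, hp1⟩
  simp only [Finset.mem_coe, Nat.mem_divisors]
  refine ⟨?_, hn.ne'⟩
  by_contra hpn
  exact hp1 (modEq_one_of_isPrimeDivisorOf_cyclotomic hn hp hpn)

/-- **Clause (2) is load-bearing (audit 2026-08-16).** Murty's impossibility statement with the
infinitude clause (2) dropped — i.e. the literal wording of Murty–Thain's Theorem 7, "Suppose that
with finitely many exceptions, all prime divisors of `f` are either `≡ 1` or `l (mod k)`. Then
`l² ≡ 1 (mod k)`" — is FALSE: `Φ₅` is non-constant and every prime divisor `p ≠ 5` of `Φ₅` is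
`≡ 1 (mod 5)`, hence lies in `{1, 2} (mod 5)`, yet `2² = 4 ≢ 1 (mod 5)`.  (Their proof uses (2);
the tree's `IsEuclideanPolynomial` keeps it, following Pollack's (2) ∧ (3) and Conrad.)
[cite: MurtyThain2006, Theorem 7 and its proof (p. 255)] [cite: Pollack2010MurtyH, §2.1 (2)–(3)] -/
theorem not_sq_modEq_one_of_restricted_primeDivisors_only :
    ¬ ∀ (m : ℕ) (a : ℤ) (f : ℤ[X]), 0 < m → 0 < f.natDegree →
      {p : ℕ | IsPrimeDivisorOf f p ∧ ¬((p : ℤ) ≡ 1 [ZMOD m] ∨ (p : ℤ) ≡ a [ZMOD m])}.Finite →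
        a ^ 2 ≡ 1 [ZMOD m] := by
  intro h
  have h5 : (0 : ℕ) < 5 := by norm_num
  have hdeg : 0 < (cyclotomic 5 ℤ).natDegree := by
    rw [natDegree_cyclotomic, Nat.totient_prime (by norm_num)]
    norm_num
  have hfin : {p : ℕ | IsPrimeDivisorOf (cyclotomic 5 ℤ) p ∧
      ¬((p : ℤ) ≡ 1 [ZMOD (5 : ℕ)] ∨ (p : ℤ) ≡ 2 [ZMOD (5 : ℕ)])}.Finite := by
    refine (finite_isPrimeDivisorOf_cyclotomic_not_modEq_one h5).subset ?_
    rintro p ⟨hp, hno⟩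
    exact ⟨hp, fun h1 => hno (Or.inl h1)⟩
  have := h 5 2 (cyclotomic 5 ℤ) h5 hdeg hfin
  revert this
  decide

end Literature.Barriers.Parity
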